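import Literature.Probability.LatticeModels.DobrushinShlosmanWeightedStates
import Literature.Probability.LatticeModels.DobrushinShlosmanUniqueness
import HarnessLib

/-!
# The WEIGHTED Dobrushin–Shlosman window comparison in INFINITE volume, for window kernels of
# ARBITRARY range: boundary insensitivity of the finite-volume kernels and uniqueness of the Gibbs measure

Topic `Literature/Probability/LatticeModels`; theorems only (no definition, no named fact).

The tree's infinite-volume Dobrushin–Shlosman files (`DobrushinShlosmanUniqueness.lean`,
`DobrushinShlosmanInfiniteVolume.lean`) need a FINITE influence radius: the window kernel at the centre `c`
must read the boundary condition on a finite locality set `nbhd c`, and the decay is measured by an `ℕ`-valued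
profile dropping by one along the support of the array. For Gibbsian specifications of absolutely summable,
infinite-range interactions (the "tier-2" perturbations of lattice gauge theory, or any quasilocal
specification) no such radius exists. The printed remedy is Föllmer's weighted form of Dobrushin's
technique (Föllmer 1988 Ch. I Cor. (2.14) "following L. Gross"; Georgii 2011 Remark 8.26; Künsch 1982): an
exponentially WEIGHTED received-sum condition `Σ_y K(c; y → x) e^{t d(c; y, x)} ≤ γ₀ < 1`, which the tree has
for overlapping windows on a FINITE cell type (`DobrushinShlosmanWeighted.lean`,
`abs_sub_le_window_weighted`). This file carries it to an ARBITRARY index set `V` and GLOBAL summable window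
arrays by the ONE-EXTERIOR-CELL device: for a finite volume `Λ` the cells are the sites of `Λ` together
with ONE cell `∞` lumping the whole exterior `V ∖ Λ` (cell type `Option ↥Λ`); the two finite-volume kernels
`γ_Λ(· | ω)`, `γ_Λ(· | η)` are functionals on bounded measurable observables of the FULL configuration,
BOTH invariant under every window kernel `γ_{win c}` with `win c ⊆ Λ` by consistency (no locality is needed:
the window kernel reads its own boundary condition everywhere), and the exterior cell, covered by no
usable window, carries the weight `θ(∞) = 1`. Hypotheses on the specification `γ` (on `V → S`, site weight
`0 ≤ r ≤ R` vanishing on the diagonal):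

* **(H1, global form)** `hcontract`: for every centre `c`, ALL pairs of boundary conditions `ω, η` and every
  bounded measurable `win c`-local `f` with site-Lipschitz vector `δ ≥ 0`,
  `|γ_{win c} f(ω) − γ_{win c} f(η)| ≤ Σ_{x ∈ win c} δ x · Σ'_y K(c; y → x) r(ω y, η y)` (Föllmer 1988 (2.20) in
  the vector form of Dobrushin–Shlosman's condition; the array `K ≥ 0` has summable weighted columns);
* **(H2, weighted)** `hsumW`: `Σ'_y K(c; y → x) e^{t d(c; y, x)} ≤ γ₀ < 1` for `x ∈ win c`, with a nonnegative
  "reach" `d(c; y, x)` and `t ≥ 0` (hence also the plain per-window received sum `≤ γ₀`).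

Results:

* `abs_integral_sub_integral_le_window_weighted` — **boundary insensitivity** (Dobrushin–Shlosman 1985,
  Theorem 1, exponential estimate; weighted form): for a finite `Λ`, boundary conditions `ω, η`, a real
  profile `ρ` with `ρ ≤ 0` off `Λ` and on the sites of `Λ` lying in no window `win c ⊆ Λ` (`c ∈ Λ`), and
  `ρ x ≤ ρ y + d(c; y, x)` whenever `x ∈ win c ⊆ Λ` receives influence from `y` (`K(c; y → x) ≠ 0`), every
  bounded measurable `Λ`-local `F` with site-Lipschitz vector `δ` obeys
  `|γ_Λ F(ω) − γ_Λ F(η)| ≤ R Σ_{x ∈ Λ} e^{−t ρ(x)} δ x`.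
* `integral_eq_integral_of_window_weighted`, `subsingleton_gibbsMeasures_of_window_weighted` —
  **uniqueness of the Gibbs measure** (Dobrushin–Shlosman 1985 Thm. 1 / Georgii 2011 Thm. 8.7 with Remark
  8.26 / Föllmer 1988 (2.9), for WINDOW kernels of infinite range): if `t > 0` and every finite `Δ` admits,
  for every level `m`, a finite `Λ ⊇ Δ` with an adapted profile `≥ m` on `Δ`, any two Gibbs measures agree
  on bounded local Lipschitz observables, hence coincide when these determine the measure.

TODO(general form): Dobrushin–Shlosman state their criterion with a general translation-invariant metric on
the window configurations; here the vector (sum-of-site-weights) form, as in the tree's finite-range files.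

## References
* R. L. Dobrushin, S. B. Shlosman, *Constructive criterion for the uniqueness of Gibbs field*, in:
  Statistical Physics and Dynamical Systems (Birkhäuser 1985) 347–370, Theorem 1, §2.
* H. Föllmer, *Random fields and diffusion processes*, LNM 1362 (1988), Ch. I (2.7)–(2.10), Cor. (2.14),
  Remark (2.17) with (2.20).
* H.-O. Georgii, *Gibbs Measures and Phase Transitions*, 2nd ed. (2011), Thm. 8.7, Thm. 8.20, Remark 8.26.
* H. Künsch, *Decay of correlations under Dobrushin's uniqueness condition and its applications*,
  Comm. Math. Phys. 84 (1982) 207–222.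
* The tree: `DobrushinShlosmanWeighted.lean` (abstract weighted iteration), `DobrushinShlosmanWindowDusting.lean`
  (window dusting for a specification read through a cell map), `DobrushinShlosmanUniqueness.lean` (pattern).
-/

noncomputable section

open MeasureTheory ProbabilityTheory Finset Function Filter
open scoped Topology
open Literature.Probability.LatticeModels.DobrushinMetric (IsLipBound integrable_of_abs_le'
  abs_sub_le_mul_sum_of_dependsOn measure_eq_of_forall_integral_eq_of_isLipBound)

namespace Literature.Probability.LatticeModels.DobrushinShlosman

variable {V S : Type*} [MeasurableSpace S]

/-! ### Summable columns: splitting off a finite volume -/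

/-- A nonnegative column dominated by its weighted version is summable. [folklore] -/
private theorem summable_of_weighted {K : V → ℝ} (hK0 : ∀ y, 0 ≤ K y) {t : ℝ} (ht : 0 ≤ t)
    {d : V → ℝ} (hd0 : ∀ y, 0 ≤ d y) (hs : Summable fun y => K y * Real.exp (t * d y)) :
    Summable K := by
  refine Summable.of_nonneg_of_le hK0 (fun y => ?_) hs
  have h1 : 1 ≤ Real.exp (t * d y) := Real.one_le_exp (mul_nonneg ht (hd0 y))
  calc K y = K y * 1 := (mul_one _).symm
    _ ≤ K y * Real.exp (t * d y) := mul_le_mul_of_nonneg_left h1 (hK0 y)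

/-- The exterior part `y ↦ 𝟙[y ∉ Λ] K y` of a summable column is summable. [folklore] -/
private theorem summable_ext [DecidableEq V] {K : V → ℝ} (hs : Summable K) (Λ : Finset V) :
    Summable fun y => if y ∈ Λ then 0 else K y := by
  have h1 : Summable fun y => if y ∈ Λ then K y else 0 :=
    summable_of_ne_finset_zero (s := Λ) fun y hy => if_neg hy
  have h2 : (fun y => if y ∈ Λ then 0 else K y) = fun y => K y - (if y ∈ Λ then K y else 0) := by
    funext y; split_ifs <;> ring
  rw [h2]
  exact hs.sub h1

/-- Splitting a series into a finite volume and its exterior: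
`Σ_{y ∈ Λ} K y + Σ'_y 𝟙[y ∉ Λ] K y = Σ'_y K y`. [folklore] -/
private theorem sum_add_tsum_ext [DecidableEq V] {K : V → ℝ} (hs : Summable K) (Λ : Finset V) :
    ∑ y ∈ Λ, K y + ∑' y, (if y ∈ Λ then 0 else K y) = ∑' y, K y := by
  have h1 : Summable fun y => if y ∈ Λ then K y else 0 :=
    summable_of_ne_finset_zero (s := Λ) fun y hy => if_neg hy
  have h3 : ∑' y, (if y ∈ Λ then K y else 0) = ∑ y ∈ Λ, K y := by
    rw [tsum_eq_sum (s := Λ) (fun y hy => if_neg hy)]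
    exact Finset.sum_congr rfl fun y hy => if_pos hy
  rw [← h3, ← h1.tsum_add (summable_ext hs Λ)]
  exact tsum_congr fun y => by split_ifs <;> ring

/-! ### Exponential insensitivity of the finite-volume kernels to the boundary condition (weighted form) -/

/-- **The weighted Dobrushin–Shlosman window comparison for two functionals in infinite volume, arbitrary
range** (the engine behind boundary insensitivity, uniqueness AND covariance decay; Dobrushin–Shlosman 1985,
Theorem, Vasserstein form; Föllmer 1988 Ch. I (2.7)–(2.10) with Cor. (2.14); Georgii 2011 Remark 8.26).
Data: a specification `γ` on `V → S` (any index set `V`); a site weight `0 ≤ r ≤ R` with `r a a = 0`; windows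
`win c` (`c : V`); an array `K(c; y → x) ≥ 0` with the GLOBAL window contraction (H1) `hcontract` and the
WEIGHTED received sums (H2) `Σ'_y K(c; y → x) e^{t d(c; y, x)} ≤ γ₀ < 1` (`x ∈ win c`, reach `d ≥ 0`, `t ≥ 0`;
summable weighted columns). Let `Λ` be finite and `E₁, E₂` two functionals that are monotone-normalised on
bounded measurable observables of the full configuration and invariant under the window kernels
`G ↦ (σ ↦ γ_{win c} G(σ))` of the USABLE centres (`c ∈ Λ`, `win c ⊆ Λ`, `P c`), and `ρ : V → ℝ` a profile
with `ρ ≤ 0` off `Λ`, `ρ ≤ 0` on the sites of `Λ` covered by no usable window, and `ρ x ≤ ρ y + d(c; y, x)`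
whenever `c` is usable, `x ∈ win c` and `K(c; y → x) ≠ 0`. Then every bounded measurable `Λ`-local `F` with
site-Lipschitz vector `δ` satisfies `|E₁ F − E₂ F| ≤ R Σ_{x ∈ Λ} e^{−t ρ(x)} δ x`.
PROOF: the tree's weighted window comparison `abs_sub_le_window_weighted` on the cell type `Option ↥Λ`
(`none` = the whole exterior `V ∖ Λ` as ONE cell, of weight `θ = 1` and cell weight `R`; no locality of the
kernels is needed since observables are functions of the full configuration); (H1) on cells from the global
(H1) (a boundary site of `Λ`: one column; the exterior cell: the lumped exterior columns times `R`); window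
dusting by `lip_windowAvg` read through the cell map; unusable centres act by the identity.
[cite: DobrushinShlosman1985, Theorem 1] [cite: Follmer1988, Ch. I Corollary (2.14)]
[cite: Georgii2011, Remark 8.26] -/
theorem abs_sub_le_window_weighted_infinite [DecidableEq V] {γ : Specification V S}
    (hγ : IsSpecification γ)
    {r : S → S → ℝ} {R : ℝ} (hr0 : ∀ a b, 0 ≤ r a b) (hrR : ∀ a b, r a b ≤ R) (hR : 0 ≤ R)
    (hrr : ∀ a, r a a = 0)
    {win : V → Finset V} {K : V → V → V → ℝ} (hK0 : ∀ c y x, 0 ≤ K c y x)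
    (hcontract : ∀ (c : V) (ω η : V → S) (f : (V → S) → ℝ) (δ : V → ℝ), Measurable f →
      (∃ B, ∀ σ, |f σ| ≤ B) → DependsOn f (win c : Set V) → (∀ x, 0 ≤ δ x) →
      (∀ (x : V) (σ τ : V → S), (∀ v, v ≠ x → σ v = τ v) → |f σ - f τ| ≤ δ x * r (σ x) (τ x)) →
        |∫ σ, f σ ∂(γ (win c) ω) - ∫ σ, f σ ∂(γ (win c) η)| ≤
          ∑ x ∈ win c, δ x * ∑' y, K c y x * r (ω y) (η y))
    {t : ℝ} (ht : 0 ≤ t) {d : V → V → V → ℝ} (hd0 : ∀ c y x, 0 ≤ d c y x)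
    (hKs : ∀ c x, Summable fun y => K c y x * Real.exp (t * d c y x))
    {γ₀ : ℝ} (hγ₀ : 0 ≤ γ₀) (hγ₁ : γ₀ < 1)
    (hsumW : ∀ c, ∀ x ∈ win c, ∑' y, K c y x * Real.exp (t * d c y x) ≤ γ₀)
    (Λ : Finset V) (P : V → Prop) [DecidablePred P] {E₁ E₂ : ((V → S) → ℝ) → ℝ}
    (h₁le : ∀ ⦃G : (V → S) → ℝ⦄ ⦃M : ℝ⦄, Measurable G → (∃ B, ∀ σ, |G σ| ≤ B) →
      (∀ σ, G σ ≤ M) → E₁ G ≤ M)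
    (h₁ge : ∀ ⦃G : (V → S) → ℝ⦄ ⦃M : ℝ⦄, Measurable G → (∃ B, ∀ σ, |G σ| ≤ B) →
      (∀ σ, M ≤ G σ) → M ≤ E₁ G)
    (h₁T : ∀ c ∈ Λ, win c ⊆ Λ → P c → ∀ ⦃G : (V → S) → ℝ⦄, Measurable G → (∃ B, ∀ σ, |G σ| ≤ B) →
      E₁ (fun σ => ∫ τ, G τ ∂(γ (win c) σ)) = E₁ G)
    (h₂le : ∀ ⦃G : (V → S) → ℝ⦄ ⦃M : ℝ⦄, Measurable G → (∃ B, ∀ σ, |G σ| ≤ B) →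
      (∀ σ, G σ ≤ M) → E₂ G ≤ M)
    (h₂ge : ∀ ⦃G : (V → S) → ℝ⦄ ⦃M : ℝ⦄, Measurable G → (∃ B, ∀ σ, |G σ| ≤ B) →
      (∀ σ, M ≤ G σ) → M ≤ E₂ G)
    (h₂T : ∀ c ∈ Λ, win c ⊆ Λ → P c → ∀ ⦃G : (V → S) → ℝ⦄, Measurable G → (∃ B, ∀ σ, |G σ| ≤ B) →
      E₂ (fun σ => ∫ τ, G τ ∂(γ (win c) σ)) = E₂ G)
    (ρ : V → ℝ) (hρout : ∀ y, y ∉ Λ → ρ y ≤ 0)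
    (hρunc : ∀ x ∈ Λ, (∀ c ∈ Λ, win c ⊆ Λ → P c → x ∉ win c) → ρ x ≤ 0)
    (hρ : ∀ c ∈ Λ, win c ⊆ Λ → P c → ∀ x ∈ win c, ∀ y, K c y x ≠ 0 → ρ x ≤ ρ y + d c y x)
    {F : (V → S) → ℝ} (hFm : Measurable F) {B : ℝ} (hB : ∀ σ, |F σ| ≤ B)
    (hFdep : DependsOn F (Λ : Set V)) {δ : V → ℝ} (hδ : IsLipBound r F δ) :
    |E₁ F - E₂ F| ≤ R * ∑ x ∈ Λ, Real.exp (-(t * ρ x)) * δ x := by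
  classical
  -- plain summability of the columns and the exterior columns
  have hKs' : ∀ c x, Summable fun y => K c y x := fun c x =>
    summable_of_weighted (fun y => hK0 c y x) ht (fun y => hd0 c y x) (hKs c x)
  -- the cell structure: sites of `Λ`, plus ONE exterior cell `none`
  let ι := Option ↥Λ
  let cell : V → ι := fun v => if h : v ∈ Λ then some ⟨v, h⟩ else none
  have cell_of_mem : ∀ {v : V} (h : v ∈ Λ), cell v = some ⟨v, h⟩ := fun h => by
    simp only [cell, dif_pos h]
  have cell_of_not_mem : ∀ {v : V}, v ∉ Λ → cell v = none := fun h => by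
    simp only [cell, dif_neg h]
  have cell_eq_some : ∀ {v : V} {x : ↥Λ}, cell v = some x ↔ v = x.1 := by
    intro v x
    constructor
    · intro h
      by_cases hv : v ∈ Λ
      · rw [cell_of_mem hv] at h
        have := Option.some_injective _ h
        rw [← this]
      · rw [cell_of_not_mem hv] at h; exact absurd h (by simp)
    · rintro rfl; rw [cell_of_mem x.2]
  have cell_eq_none : ∀ {v : V}, cell v = none ↔ v ∉ Λ := by
    intro v
    constructor
    · intro h hv; rw [cell_of_mem hv] at h; exact absurd h (by simp)
    · exact cell_of_not_mem
  -- the cell weight: `r` on the sites of `Λ`, the constant `R` on the exterior cell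
  let w : ι → (V → S) → (V → S) → ℝ := fun x σ τ =>
    match x with
    | some x => r (σ x.1) (τ x.1)
    | none => R
  have hwR : ∀ x σ τ, w x σ τ ≤ R := fun x σ τ => by
    cases x with
    | none => exact le_rfl
    | some x => exact hrR _ _
  have hw0 : ∀ x σ τ, 0 ≤ w x σ τ := fun x σ τ => by
    cases x with
    | none => exact hR
    | some x => exact hr0 _ _
  have hwloc : ∀ (x : ι) (σ σ' τ τ' : V → S), (∀ v, cell v = x → σ v = σ' v) →
      (∀ v, cell v = x → τ v = τ' v) → w x σ τ = w x σ' τ' := by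
    intro x σ σ' τ τ' hσ hτ
    cases x with
    | none => rfl
    | some x =>
      show r (σ x.1) (τ x.1) = r (σ' x.1) (τ' x.1)
      rw [hσ x.1 (cell_of_mem x.2), hτ x.1 (cell_of_mem x.2)]
  -- usable centres: `c ∈ Λ` with `win c ⊆ Λ`; their cell windows and cell arrays
  let usable : ↥Λ → Prop := fun c => win c.1 ⊆ Λ ∧ P c.1
  let winC : ↥Λ → Finset ι := fun c => ((win c.1).subtype (· ∈ Λ)).map (Embedding.some)
  have mem_winC : ∀ {c : ↥Λ} (hc : usable c) {x : ι}, x ∈ winC c ↔ ∃ v ∈ win c.1, cell v = x := by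
    intro c hc x
    simp only [winC, Finset.mem_map, Finset.mem_subtype]
    constructor
    · rintro ⟨⟨v, hvΛ⟩, hv, rfl⟩
      exact ⟨v, hv, cell_of_mem hvΛ⟩
    · rintro ⟨v, hv, hcv⟩
      refine ⟨⟨v, hc.1 hv⟩, hv, ?_⟩
      rw [← hcv, cell_of_mem (hc.1 hv)]
      rfl
  have some_mem_winC : ∀ {c : ↥Λ} (hc : usable c) {x : ↥Λ}, some x ∈ winC c ↔ x.1 ∈ win c.1 := by
    intro c hc x
    rw [mem_winC hc]
    constructor
    · rintro ⟨v, hv, hcv⟩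
      rwa [cell_eq_some.1 hcv] at hv
    · intro hx
      exact ⟨x.1, hx, cell_of_mem x.2⟩
  have none_not_mem_winC : ∀ (c : ↥Λ), none ∉ winC c := fun c h => by
    simp only [winC, Finset.mem_map] at h
    obtain ⟨_, _, h⟩ := h
    exact Option.some_ne_none _ h
  have hΛC : ∀ {c : ↥Λ}, usable c → ∀ v, v ∈ win c.1 ↔ cell v ∈ winC c := by
    intro c hc v
    rw [mem_winC hc]
    constructor
    · intro hv; exact ⟨v, hv, rfl⟩
    · rintro ⟨v', hv', hcv⟩
      by_cases hvΛ : v ∈ Λ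
      · have hv'Λ : v' ∈ Λ := hc.1 hv'
        rw [cell_of_mem hv'Λ, cell_of_mem hvΛ] at hcv
        have := Subtype.ext_iff.1 (Option.some_injective _ hcv)
        simp only at this
        rwa [← this]
      · have hv'Λ : v' ∈ Λ := hc.1 hv'
        rw [cell_of_mem hv'Λ, cell_of_not_mem hvΛ] at hcv
        exact absurd hcv (by simp)
  -- the cell array of a usable centre: `K` between sites of `Λ`, the lumped exterior column into `x`
  let kC : ↥Λ → ι → ι → ℝ := fun c y x =>
    match x with
    | none => 0
    | some x =>
      match y with
      | some y => K c.1 y.1 x.1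
      | none => ∑' v, (if v ∈ Λ then 0 else K c.1 v x.1)
  have hkC0 : ∀ c y x, 0 ≤ kC c y x := fun c y x => by
    cases x with
    | none => exact le_rfl
    | some x =>
      cases y with
      | some y => exact hK0 _ _ _
      | none =>
        exact tsum_nonneg fun v => by split_ifs; exacts [le_rfl, hK0 _ _ _]
  -- (H1) on cells for a usable centre, from the global window contraction
  have hcontractC : ∀ (c : ↥Λ), usable c → ∀ y, y ∉ winC c → ∀ (ω' η' : V → S),
      (∀ v, cell v ≠ y → ω' v = η' v) →
      ∀ (f : (V → S) → ℝ) (δ' : ι → ℝ), Measurable f → (∃ B, ∀ σ, |f σ| ≤ B) →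
        DependsOn f {v | cell v ∈ winC c} → (∀ x, 0 ≤ δ' x) →
        (∀ (x : ι) (σ τ : V → S), (∀ v, cell v ≠ x → σ v = τ v) → |f σ - f τ| ≤ δ' x * w x σ τ) →
          |∫ σ, f σ ∂(γ (win c.1) ω') - ∫ σ, f σ ∂(γ (win c.1) η')| ≤
            (∑ x ∈ winC c, kC c y x * δ' x) * w y ω' η' := by
    intro c hc y hy ω' η' hωη f δ' hfm hfB hfdep hδ'0 hδ'
    -- `f` is `win c`-local with the site-Lipschitz vector `δV`
    have hfdepV : DependsOn f (win c.1 : Set V) := fun σ τ hστ =>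
      hfdep fun v (hv : cell v ∈ winC c) => hστ v (Finset.mem_coe.2 ((hΛC hc v).2 hv))
    let δV : V → ℝ := fun v => if h : v ∈ Λ then δ' (some ⟨v, h⟩) else 0
    have hδV0 : ∀ v, 0 ≤ δV v := fun v => by
      simp only [δV]; split_ifs; exacts [hδ'0 _, le_rfl]
    have hδV : ∀ (x : V) (σ τ : V → S), (∀ v, v ≠ x → σ v = τ v) →
        |f σ - f τ| ≤ δV x * r (σ x) (τ x) := by
      intro x σ τ hστ
      by_cases hx : x ∈ Λ
      · have h := hδ' (some ⟨x, hx⟩) σ τ fun v hv => hστ v fun hvx => hv (hvx ▸ cell_of_mem hx)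
        simp only [δV, dif_pos hx]
        exact h
      · have hxw : x ∉ win c.1 := fun h => hx (hc.1 h)
        rw [hfdepV fun v hv => hστ v fun hvx => hxw (hvx ▸ Finset.mem_coe.1 hv), sub_self, abs_zero]
        exact mul_nonneg (hδV0 x) (hr0 _ _)
    have key := hcontract c.1 ω' η' f δV hfm hfB hfdepV hδV0 hδV
    -- rewrite the site sum over `win c` as the cell sum over `winC c`
    have hsumC : ∀ (g : V → ℝ), ∑ x ∈ win c.1, δV x * g x =
        ∑ x ∈ winC c, (match x with | none => 0 | some x => g x.1) * δ' x := by
      intro g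
      rw [show winC c = ((win c.1).subtype (· ∈ Λ)).map Embedding.some from rfl, Finset.sum_map,
        ← Finset.sum_subtype_of_mem (f := fun x => δV x * g x) (fun x hx => hc.1 hx)]
      refine Finset.sum_congr rfl fun x _ => ?_
      change δV x.1 * g x.1 = g x.1 * δ' (some x)
      simp only [δV, dif_pos x.2]
      ring
    refine key.trans ?_
    cases y with
    | some y =>
      -- `ω' = η'` off the site `y`: only the column `y` survives
      have hωηV : ∀ v, v ≠ y.1 → ω' v = η' v := fun v hv =>
        hωη v fun h => hv (cell_eq_some.1 h)
      have hcol : ∀ x, ∑' v, K c.1 v x * r (ω' v) (η' v) = K c.1 y.1 x * r (ω' y.1) (η' y.1) := by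
        intro x
        rw [tsum_eq_single y.1 (fun v hv => by rw [hωηV v hv, hrr, mul_zero])]
      simp_rw [hcol]
      have : ∑ x ∈ win c.1, δV x * (K c.1 y.1 x * r (ω' y.1) (η' y.1)) =
          (∑ x ∈ win c.1, δV x * K c.1 y.1 x) * r (ω' y.1) (η' y.1) := by
        rw [Finset.sum_mul]; exact Finset.sum_congr rfl fun x _ => by ring
      rw [this, hsumC (fun x => K c.1 y.1 x)]
    | none =>
      -- `ω' = η'` on `Λ`: only the exterior columns survive, each weighted by `r ≤ R`
      have hωηV : ∀ v ∈ Λ, ω' v = η' v := fun v hv => hωη v (by rw [cell_of_mem hv]; simp)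
      have hcol : ∀ x, ∑' v, K c.1 v x * r (ω' v) (η' v) ≤
          (∑' v, (if v ∈ Λ then 0 else K c.1 v x)) * R := by
        intro x
        rw [← tsum_mul_right]
        refine Summable.tsum_le_tsum (fun v => ?_) ?_ ((summable_ext (hKs' c.1 x) Λ).mul_right R)
        · split_ifs with hv
          · rw [hωηV v hv, hrr, mul_zero, zero_mul]
          · exact mul_le_mul_of_nonneg_left (hrR _ _) (hK0 _ _ _)
        · exact Summable.of_nonneg_of_le (fun v => mul_nonneg (hK0 _ _ _) (hr0 _ _))
            (fun v => mul_le_mul_of_nonneg_left (hrR _ _) (hK0 _ _ _)) ((hKs' c.1 x).mul_right R)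
      calc ∑ x ∈ win c.1, δV x * ∑' v, K c.1 v x * r (ω' v) (η' v)
          ≤ ∑ x ∈ win c.1, δV x * ((∑' v, (if v ∈ Λ then 0 else K c.1 v x)) * R) :=
            Finset.sum_le_sum fun x _ => mul_le_mul_of_nonneg_left (hcol x) (hδV0 x)
        _ = (∑ x ∈ win c.1, δV x * ∑' v, (if v ∈ Λ then 0 else K c.1 v x)) * R := by
            rw [Finset.sum_mul]; exact Finset.sum_congr rfl fun x _ => by ring
        _ = (∑ x ∈ winC c, kC c none x * δ' x) * w none ω' η' := by
            rw [hsumC (fun x => ∑' v, (if v ∈ Λ then 0 else K c.1 v x))]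
  -- admissible observables, cell-Lipschitz vectors, window operators on `Option ↥Λ`
  set Adm : ((V → S) → ℝ) → Prop := fun G => Measurable G ∧ ∃ B, ∀ σ, |G σ| ≤ B with hAdm
  set Lip : ((V → S) → ℝ) → (ι → ℝ) → Prop := fun G δ' => (∀ x, 0 ≤ δ' x) ∧
    ∀ (x : ι) (σ τ : V → S), (∀ v, cell v ≠ x → σ v = τ v) → |G σ - G τ| ≤ δ' x * w x σ τ with hLip
  let T : ι → ((V → S) → ℝ) → ((V → S) → ℝ) := fun c G =>
    match c with
    | none => G
    | some c => if usable c then fun σ => ∫ τ, G τ ∂(γ (win c.1) σ) else G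
  let win' : ι → Finset ι := fun c =>
    match c with
    | none => ∅
    | some c => if usable c then winC c else ∅
  let k' : ι → ι → ι → ℝ := fun c y x =>
    match c with
    | none => 0
    | some c => if usable c then kC c y x else 0
  have T_usable : ∀ {c : ↥Λ}, usable c → ∀ G, T (some c) G = fun σ => ∫ τ, G τ ∂(γ (win c.1) σ) :=
    fun hc G => by simp only [T, if_pos hc]
  have T_unusable : ∀ {c : ↥Λ}, ¬ usable c → ∀ G, T (some c) G = G :=
    fun hc G => by simp only [T, if_neg hc]
  have win'_usable : ∀ {c : ↥Λ}, usable c → win' (some c) = winC c :=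
    fun hc => by simp only [win', if_pos hc]
  have win'_unusable : ∀ {c : ↥Λ}, ¬ usable c → win' (some c) = ∅ :=
    fun hc => by simp only [win', if_neg hc]
  have k'_usable : ∀ {c : ↥Λ}, usable c → ∀ y x, k' (some c) y x = kC c y x :=
    fun hc y x => by simp only [k', if_pos hc]
  have k'_unusable : ∀ {c : ↥Λ}, ¬ usable c → ∀ y x, k' (some c) y x = 0 :=
    fun hc y x => by simp only [k', if_neg hc]
  -- (hlip0), (hosc), (hk)
  have hlip0 : ∀ ⦃G : (V → S) → ℝ⦄ ⦃δ' : ι → ℝ⦄, Lip G δ' → ∀ x, 0 ≤ δ' x := fun G δ' h => h.1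
  have hoscA : ∀ ⦃G : (V → S) → ℝ⦄ ⦃δ' : ι → ℝ⦄, Adm G → Lip G δ' →
      ∀ σ τ, |G σ - G τ| ≤ R * ∑ x, δ' x := fun G δ' _ h => abs_sub_le_sum_cells hwR h.1 h.2
  have hk : ∀ c y x, 0 ≤ k' c y x := fun c y x => by
    cases c with
    | none => exact le_rfl
    | some c =>
      by_cases hc : usable c
      · rw [k'_usable hc]; exact hkC0 _ _ _
      · rw [k'_unusable hc]
  -- trivial dusting for the identity operator
  have lip_id : ∀ ⦃G : (V → S) → ℝ⦄ ⦃δ' : ι → ℝ⦄, Lip G δ' →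
      Lip G fun y => if y ∈ (∅ : Finset ι) then 0 else δ' y + ∑ x ∈ (∅ : Finset ι), (0 : ℝ) * δ' x := by
    intro G δ' h
    simp only [Finset.notMem_empty, if_false, Finset.sum_empty, add_zero]
    exact h
  -- (hT) the window operators preserve admissibility
  have hTA : ∀ ⦃G : (V → S) → ℝ⦄ (c : ι), Adm G → Adm (T c G) := by
    rintro G c ⟨hGm, B', hB'⟩
    cases c with
    | none => exact ⟨hGm, B', hB'⟩
    | some c =>
      by_cases hc : usable c
      · rw [T_usable hc]
        exact ⟨measurable_windowAvg' hγ (win c.1) hGm, B', fun σ => abs_windowAvg_le' hγ (win c.1) hB' σ⟩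
      · rw [T_unusable hc]; exact ⟨hGm, B', hB'⟩
  -- (hdust) the window dusting estimate
  have hdust : ∀ ⦃G : (V → S) → ℝ⦄ ⦃δ' : ι → ℝ⦄ (c : ι), Adm G → Lip G δ' →
      Lip (T c G) fun y => if y ∈ win' c then 0 else δ' y + ∑ x ∈ win' c, k' c y x * δ' x := by
    intro G δ' c hG hδ'
    obtain ⟨hGm, B', hB'⟩ := hG
    cases c with
    | none => exact lip_id hδ'
    | some c =>
      by_cases hc : usable c
      · rw [T_usable hc, win'_usable hc]
        simp_rw [k'_usable hc]
        refine ⟨fun y => ?_, fun y σ τ hστ =>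
          lip_windowAvg hγ hwloc (hΛC hc) (hcontractC c hc) hGm hB' hδ'.1 hδ'.2 y σ τ hστ⟩
        dsimp only
        split_ifs
        · exact le_rfl
        · exact add_nonneg (hδ'.1 y) (Finset.sum_nonneg fun x _ => mul_nonneg (hkC0 c y x) (hδ'.1 x))
      · rw [T_unusable hc, win'_unusable hc]
        simp_rw [k'_unusable hc]
        exact lip_id hδ'
  -- the two functionals are invariant under EVERY window operator (usable: hypothesis; else identity)
  have hinv : ∀ {E : ((V → S) → ℝ) → ℝ},
      (∀ c ∈ Λ, win c ⊆ Λ → P c → ∀ ⦃G : (V → S) → ℝ⦄, Measurable G → (∃ B, ∀ σ, |G σ| ≤ B) →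
        E (fun σ => ∫ τ, G τ ∂(γ (win c) σ)) = E G) →
      ∀ ⦃G : (V → S) → ℝ⦄ (c : ι), c ∈ (Finset.univ : Finset ι) → Adm G → E (T c G) = E G := by
    rintro E hE G c - ⟨hGm, B', hB'⟩
    cases c with
    | none => rfl
    | some c =>
      by_cases hc : usable c
      · rw [T_usable hc]
        exact hE c.1 c.2 hc.1 hc.2 hGm ⟨B', hB'⟩
      · rw [T_unusable hc]
  -- the weight: `e^{-t ρ}` on the sites of `Λ`, `1` on the exterior cell
  let θ : ι → ℝ := fun x =>
    match x with
    | none => 1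
    | some x => Real.exp (-(t * ρ x.1))
  have hθ0 : ∀ x, 0 ≤ θ x := fun x => by
    cases x with
    | none => exact zero_le_one
    | some x => exact Real.exp_nonneg _
  have hθ1 : ∀ x, (∀ c ∈ (Finset.univ : Finset ι), x ∉ win' c) → 1 ≤ θ x := by
    intro x hx
    cases x with
    | none => exact le_rfl
    | some x =>
      show 1 ≤ Real.exp (-(t * ρ x.1))
      have hρx : ρ x.1 ≤ 0 := hρunc x.1 x.2 fun c hc hcw hP hxw =>
        hx (some ⟨c, hc⟩) (Finset.mem_univ _) (by
          rw [win'_usable (c := ⟨c, hc⟩) ⟨hcw, hP⟩, some_mem_winC (c := ⟨c, hc⟩) ⟨hcw, hP⟩]; exact hxw)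
      exact Real.one_le_exp (by nlinarith)
  -- the received sums of a usable centre: plain and weighted
  have hsum_cells : ∀ {c : ↥Λ} (hc : usable c) (x : ↥Λ) (a : ι → ℝ),
      ∑ y, kC c y (some x) * a y =
        ∑ y ∈ Λ.attach, K c.1 y.1 x.1 * a (some y) +
          (∑' v, (if v ∈ Λ then 0 else K c.1 v x.1)) * a none := by
    intro c hc x a
    rw [Fintype.sum_option, add_comm]
    rfl
  have hsumU : ∀ c ∈ (Finset.univ : Finset ι), ∀ x ∈ win' c, ∑ y, k' c y x ≤ γ₀ := by
    rintro c - x hx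
    cases c with
    | none => exact absurd hx (Finset.notMem_empty _)
    | some c =>
      by_cases hc : usable c
      · rw [win'_usable hc] at hx
        simp_rw [k'_usable hc]
        cases x with
        | none => exact absurd hx (none_not_mem_winC c)
        | some x =>
          have hxw : x.1 ∈ win c.1 := (some_mem_winC hc).1 hx
          have h := hsum_cells hc x fun _ => 1
          simp only [mul_one] at h
          rw [h]
          have h2 : ∑ y ∈ Λ.attach, K c.1 y.1 x.1 = ∑ y ∈ Λ, K c.1 y x.1 :=
            Finset.sum_attach Λ (fun y => K c.1 y x.1)
          rw [h2, sum_add_tsum_ext (hKs' c.1 x.1) Λ]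
          refine le_trans (Summable.tsum_le_tsum (fun y => ?_) (hKs' c.1 x.1) (hKs c.1 x.1)) (hsumW c.1 x.1 hxw)
          have h1 : 1 ≤ Real.exp (t * d c.1 y x.1) := Real.one_le_exp (mul_nonneg ht (hd0 _ _ _))
          calc K c.1 y x.1 = K c.1 y x.1 * 1 := (mul_one _).symm
            _ ≤ K c.1 y x.1 * Real.exp (t * d c.1 y x.1) := mul_le_mul_of_nonneg_left h1 (hK0 _ _ _)
      · rw [win'_unusable hc] at hx; exact absurd hx (Finset.notMem_empty _)
  have hsumθ : ∀ c ∈ (Finset.univ : Finset ι), ∀ x ∈ win' c, ∑ y, k' c y x * θ y ≤ γ₀ * θ x := by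
    rintro c - x hx
    cases c with
    | none => exact absurd hx (Finset.notMem_empty _)
    | some c =>
      by_cases hc : usable c
      · rw [win'_usable hc] at hx
        simp_rw [k'_usable hc]
        cases x with
        | none => exact absurd hx (none_not_mem_winC c)
        | some x =>
          have hxw : x.1 ∈ win c.1 := (some_mem_winC hc).1 hx
          rw [hsum_cells hc x θ]
          show ∑ y ∈ Λ.attach, K c.1 y.1 x.1 * Real.exp (-(t * ρ y.1)) +
              (∑' v, (if v ∈ Λ then 0 else K c.1 v x.1)) * 1 ≤ γ₀ * Real.exp (-(t * ρ x.1))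
          -- pointwise: `K(c; y → x) e^{-t ρ y} ≤ e^{-t ρ x} K(c; y → x) e^{t d(c; y, x)}`, on and off `Λ`
          have hpt : ∀ y, K c.1 y x.1 * Real.exp (-(t * ρ y)) ≤
              Real.exp (-(t * ρ x.1)) * (K c.1 y x.1 * Real.exp (t * d c.1 y x.1)) := by
            intro y
            by_cases hKy : K c.1 y x.1 = 0
            · rw [hKy]; simp
            · have hρxy := hρ c.1 c.2 hc.1 hc.2 x.1 hxw y hKy
              have hexp : Real.exp (-(t * ρ y)) ≤ Real.exp (-(t * ρ x.1)) * Real.exp (t * d c.1 y x.1) := by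
                rw [← Real.exp_add]
                exact Real.exp_le_exp.2 (by nlinarith)
              calc K c.1 y x.1 * Real.exp (-(t * ρ y))
                  ≤ K c.1 y x.1 * (Real.exp (-(t * ρ x.1)) * Real.exp (t * d c.1 y x.1)) :=
                    mul_le_mul_of_nonneg_left hexp (hK0 _ _ _)
                _ = _ := by ring
          have hin : ∑ y ∈ Λ.attach, K c.1 y.1 x.1 * Real.exp (-(t * ρ y.1)) ≤
              ∑ y ∈ Λ, Real.exp (-(t * ρ x.1)) * (K c.1 y x.1 * Real.exp (t * d c.1 y x.1)) := by
            rw [← Finset.sum_attach Λ (fun y => Real.exp (-(t * ρ x.1)) * (K c.1 y x.1 * Real.exp (t * d c.1 y x.1)))]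
            exact Finset.sum_le_sum fun y _ => hpt y.1
          have hout : (∑' v, (if v ∈ Λ then 0 else K c.1 v x.1)) * 1 ≤
              ∑' v, (if v ∈ Λ then 0 else Real.exp (-(t * ρ x.1)) * (K c.1 v x.1 * Real.exp (t * d c.1 v x.1))) := by
            rw [mul_one]
            refine Summable.tsum_le_tsum (fun v => ?_) (summable_ext (hKs' c.1 x.1) Λ)
              (summable_ext ((hKs c.1 x.1).mul_left _) Λ)
            split_ifs with hv
            · exact le_rfl
            · have h1 : 1 ≤ Real.exp (-(t * ρ v)) :=
                Real.one_le_exp (by nlinarith [hρout v hv])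
              calc K c.1 v x.1 = K c.1 v x.1 * 1 := (mul_one _).symm
                _ ≤ K c.1 v x.1 * Real.exp (-(t * ρ v)) := mul_le_mul_of_nonneg_left h1 (hK0 _ _ _)
                _ ≤ _ := hpt v
          calc _ ≤ ∑ y ∈ Λ, Real.exp (-(t * ρ x.1)) * (K c.1 y x.1 * Real.exp (t * d c.1 y x.1)) +
                ∑' v, (if v ∈ Λ then 0 else
                  Real.exp (-(t * ρ x.1)) * (K c.1 v x.1 * Real.exp (t * d c.1 v x.1))) := add_le_add hin hout
            _ = ∑' y, Real.exp (-(t * ρ x.1)) * (K c.1 y x.1 * Real.exp (t * d c.1 y x.1)) :=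
                sum_add_tsum_ext ((hKs c.1 x.1).mul_left _) Λ
            _ = Real.exp (-(t * ρ x.1)) * ∑' y, K c.1 y x.1 * Real.exp (t * d c.1 y x.1) := tsum_mul_left
            _ ≤ Real.exp (-(t * ρ x.1)) * γ₀ :=
                mul_le_mul_of_nonneg_left (hsumW c.1 x.1 hxw) (Real.exp_nonneg _)
            _ = γ₀ * Real.exp (-(t * ρ x.1)) := mul_comm _ _
      · rw [win'_unusable hc] at hx; exact absurd hx (Finset.notMem_empty _)
  -- the data of `F`: its cell-Lipschitz vector vanishes on the exterior cell
  let δ' : ι → ℝ := fun x =>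
    match x with
    | none => 0
    | some x => δ x.1
  have hFA : Adm F := ⟨hFm, B, hB⟩
  have hδ' : Lip F δ' := by
    refine ⟨fun x => ?_, fun x σ τ hστ => ?_⟩
    · cases x with
      | none => exact le_rfl
      | some x => exact hδ.nonneg _
    · cases x with
      | none =>
        -- `σ = τ` on `Λ`, and `F` reads only `Λ`
        have hστΛ : ∀ v ∈ (Λ : Set V), σ v = τ v := fun v hv =>
          hστ v (by rw [cell_of_mem (Finset.mem_coe.1 hv)]; simp)
        rw [hFdep hστΛ, sub_self, abs_zero]
        exact mul_nonneg le_rfl (hw0 none σ τ)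
      | some x =>
        exact hδ.le x.1 σ τ fun v hv => hστ v fun h => hv (cell_eq_some.1 h)
  -- the weighted window comparison theorem on the cell type `Option ↥Λ`
  have key := abs_sub_le_window_weighted (ι := ι) (Ω := V → S) (Adm := Adm) (Lip := Lip) (T := T)
    (win := win') (k := k') (U := Finset.univ) (E₁ := E₁) (E₂ := E₂) hR hlip0 hoscA hk hTA hdust
    (fun G M hG hM => h₁le hG.1 hG.2 hM) (fun G M hG hM => h₁ge hG.1 hG.2 hM) (hinv h₁T)
    (fun G M hG hM => h₂le hG.1 hG.2 hM) (fun G M hG hM => h₂ge hG.1 hG.2 hM) (hinv h₂T) hγ₀ hγ₁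
    hsumU hθ0 hθ1 hsumθ hFA hδ'
  have hs : ∑ x, θ x * δ' x = ∑ x ∈ Λ, Real.exp (-(t * ρ x)) * δ x := by
    rw [Fintype.sum_option]
    show (1 : ℝ) * 0 + ∑ x : ↥Λ, Real.exp (-(t * ρ x.1)) * δ x.1 = _
    rw [one_mul, zero_add]
    exact Finset.sum_coe_sort Λ (fun x => Real.exp (-(t * ρ x)) * δ x)
  rw [hs] at key
  exact key

/-- **Dobrushin–Shlosman, weighted form, arbitrary range: the finite-volume kernels forget the boundary
condition exponentially fast in the depth** (Dobrushin–Shlosman 1985, Theorem 1, the exponential estimate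
behind uniqueness; 1987 §2 condition IIIc; weighted form of Georgii 2011 Remark 8.26). In the setting of
`abs_sub_le_window_weighted_infinite`, for a finite `Λ`, two boundary conditions `ω, η` and a profile `ρ`
with `ρ ≤ 0` off `Λ` and on the sites of `Λ` in no window `win c ⊆ Λ` (`c ∈ Λ`), `ρ x ≤ ρ y + d(c; y, x)` along
the support of `K` for such windows, every bounded measurable `Λ`-local `F` with site-Lipschitz vector `δ`
satisfies `|∫ F dγ_Λ(·|ω) − ∫ F dγ_Λ(·|η)| ≤ R Σ_{x ∈ Λ} e^{−t ρ(x)} δ x` — BOTH kernels are invariant under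
every window kernel inside `Λ` by consistency. [cite: DobrushinShlosman1985, Theorem 1]
[cite: Georgii2011, Remark 8.26] -/
theorem abs_integral_sub_integral_le_window_weighted [DecidableEq V] {γ : Specification V S}
    (hγ : IsSpecification γ)
    {r : S → S → ℝ} {R : ℝ} (hr0 : ∀ a b, 0 ≤ r a b) (hrR : ∀ a b, r a b ≤ R) (hR : 0 ≤ R)
    (hrr : ∀ a, r a a = 0)
    {win : V → Finset V} {K : V → V → V → ℝ} (hK0 : ∀ c y x, 0 ≤ K c y x)
    (hcontract : ∀ (c : V) (ω η : V → S) (f : (V → S) → ℝ) (δ : V → ℝ), Measurable f →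
      (∃ B, ∀ σ, |f σ| ≤ B) → DependsOn f (win c : Set V) → (∀ x, 0 ≤ δ x) →
      (∀ (x : V) (σ τ : V → S), (∀ v, v ≠ x → σ v = τ v) → |f σ - f τ| ≤ δ x * r (σ x) (τ x)) →
        |∫ σ, f σ ∂(γ (win c) ω) - ∫ σ, f σ ∂(γ (win c) η)| ≤
          ∑ x ∈ win c, δ x * ∑' y, K c y x * r (ω y) (η y))
    {t : ℝ} (ht : 0 ≤ t) {d : V → V → V → ℝ} (hd0 : ∀ c y x, 0 ≤ d c y x)
    (hKs : ∀ c x, Summable fun y => K c y x * Real.exp (t * d c y x))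
    {γ₀ : ℝ} (hγ₀ : 0 ≤ γ₀) (hγ₁ : γ₀ < 1)
    (hsumW : ∀ c, ∀ x ∈ win c, ∑' y, K c y x * Real.exp (t * d c y x) ≤ γ₀)
    (Λ : Finset V) (ω η : V → S) (ρ : V → ℝ) (hρout : ∀ y, y ∉ Λ → ρ y ≤ 0)
    (hρunc : ∀ x ∈ Λ, (∀ c ∈ Λ, win c ⊆ Λ → x ∉ win c) → ρ x ≤ 0)
    (hρ : ∀ c ∈ Λ, win c ⊆ Λ → ∀ x ∈ win c, ∀ y, K c y x ≠ 0 → ρ x ≤ ρ y + d c y x)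
    {F : (V → S) → ℝ} (hFm : Measurable F) {B : ℝ} (hB : ∀ σ, |F σ| ≤ B)
    (hFdep : DependsOn F (Λ : Set V)) {δ : V → ℝ} (hδ : IsLipBound r F δ) :
    |∫ σ, F σ ∂(γ Λ ω) - ∫ σ, F σ ∂(γ Λ η)| ≤ R * ∑ x ∈ Λ, Real.exp (-(t * ρ x)) * δ x := by
  classical
  -- the kernels are monotone-normalised …
  have hle : ∀ (ζ : V → S) ⦃G : (V → S) → ℝ⦄ ⦃M : ℝ⦄, Measurable G → (∃ B, ∀ σ, |G σ| ≤ B) →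
      (∀ σ, G σ ≤ M) → ∫ σ, G σ ∂(γ Λ ζ) ≤ M := by
    rintro ζ G M hGm ⟨B', hB'⟩ hM
    haveI := hγ.isProbability Λ ζ
    calc ∫ σ, G σ ∂(γ Λ ζ) ≤ ∫ _σ, M ∂(γ Λ ζ) :=
          integral_mono (integrable_of_abs_le' hGm hB') (integrable_const M) hM
      _ = M := by simp
  have hge : ∀ (ζ : V → S) ⦃G : (V → S) → ℝ⦄ ⦃M : ℝ⦄, Measurable G → (∃ B, ∀ σ, |G σ| ≤ B) →
      (∀ σ, M ≤ G σ) → M ≤ ∫ σ, G σ ∂(γ Λ ζ) := by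
    rintro ζ G M hGm ⟨B', hB'⟩ hM
    haveI := hγ.isProbability Λ ζ
    calc M = ∫ _σ, M ∂(γ Λ ζ) := by simp
      _ ≤ ∫ σ, G σ ∂(γ Λ ζ) := integral_mono (integrable_const M) (integrable_of_abs_le' hGm hB') hM
  -- … and invariant under every window kernel inside `Λ` (consistency)
  have hinv : ∀ (ζ : V → S), ∀ c ∈ Λ, win c ⊆ Λ → True → ∀ ⦃G : (V → S) → ℝ⦄, Measurable G →
      (∃ B, ∀ σ, |G σ| ≤ B) → ∫ σ, (∫ τ, G τ ∂(γ (win c) σ)) ∂(γ Λ ζ) = ∫ σ, G σ ∂(γ Λ ζ) := by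
    rintro ζ c - hc - G hGm ⟨B', hB'⟩
    haveI := hγ.isProbability Λ ζ
    exact hγ.integral_integral_consistent hc ζ (integrable_of_abs_le' hGm hB')
  exact abs_sub_le_window_weighted_infinite hγ hr0 hrR hR hrr hK0 hcontract ht hd0 hKs hγ₀ hγ₁ hsumW Λ
    (fun _ => True) (hle ω) (hge ω) (hinv ω) (hle η) (hge η) (hinv η) ρ hρout
    (fun x hx h => hρunc x hx fun c hc hcw => h c hc hcw trivial)
    (fun c hc hcw _ => hρ c hc hcw) hFm hB hFdep hδ

/-! ### Uniqueness of the Gibbs measure -/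

/-- **Two Gibbs measures agree on bounded local Lipschitz observables under the weighted window condition**
(Dobrushin–Shlosman 1985, Thm. 1 / Georgii 2011 Thm. 8.7 with Remark 8.26 / Föllmer 1988 (2.9), Vasserstein
form, for window kernels of ARBITRARY range; the DLR equations turn `μ F − ν F` into a double average of
`γ_Λ F(ω) − γ_Λ F(η)`, which `abs_integral_sub_integral_le_window_weighted` bounds by `R e^{−t m} Σ_Δ δ` for
every level `m` along an exhaustion of `V` by finite volumes carrying adapted profiles `≥ m` on `Δ`).
[cite: DobrushinShlosman1985, Theorem 1] [cite: Georgii2011, Remark 8.26] -/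
theorem integral_eq_integral_of_window_weighted [DecidableEq V] {γ : Specification V S}
    (hγ : IsSpecification γ)
    {r : S → S → ℝ} {R : ℝ} (hr0 : ∀ a b, 0 ≤ r a b) (hrR : ∀ a b, r a b ≤ R) (hR : 0 ≤ R)
    (hrr : ∀ a, r a a = 0)
    {win : V → Finset V} {K : V → V → V → ℝ} (hK0 : ∀ c y x, 0 ≤ K c y x)
    (hcontract : ∀ (c : V) (ω η : V → S) (f : (V → S) → ℝ) (δ : V → ℝ), Measurable f →
      (∃ B, ∀ σ, |f σ| ≤ B) → DependsOn f (win c : Set V) → (∀ x, 0 ≤ δ x) →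
      (∀ (x : V) (σ τ : V → S), (∀ v, v ≠ x → σ v = τ v) → |f σ - f τ| ≤ δ x * r (σ x) (τ x)) →
        |∫ σ, f σ ∂(γ (win c) ω) - ∫ σ, f σ ∂(γ (win c) η)| ≤
          ∑ x ∈ win c, δ x * ∑' y, K c y x * r (ω y) (η y))
    {t : ℝ} (ht : 0 < t) {d : V → V → V → ℝ} (hd0 : ∀ c y x, 0 ≤ d c y x)
    (hKs : ∀ c x, Summable fun y => K c y x * Real.exp (t * d c y x))
    {γ₀ : ℝ} (hγ₀ : 0 ≤ γ₀) (hγ₁ : γ₀ < 1)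
    (hsumW : ∀ c, ∀ x ∈ win c, ∑' y, K c y x * Real.exp (t * d c y x) ≤ γ₀)
    (hexh : ∀ (Δ : Finset V) (m : ℕ), ∃ (Λ : Finset V) (ρ : V → ℝ), Δ ⊆ Λ ∧
      (∀ y, y ∉ Λ → ρ y ≤ 0) ∧ (∀ x ∈ Λ, (∀ c ∈ Λ, win c ⊆ Λ → x ∉ win c) → ρ x ≤ 0) ∧
      (∀ c ∈ Λ, win c ⊆ Λ → ∀ x ∈ win c, ∀ y, K c y x ≠ 0 → ρ x ≤ ρ y + d c y x) ∧
      (∀ x ∈ Δ, (m : ℝ) ≤ ρ x))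
    {μ ν : Measure (V → S)} (hμ : IsGibbsMeasure γ μ) (hν : IsGibbsMeasure γ ν)
    {F : (V → S) → ℝ} (hFm : Measurable F) {B : ℝ} (hB : ∀ σ, |F σ| ≤ B) {Δ : Finset V}
    (hFdep : DependsOn F (Δ : Set V)) {δ : V → ℝ} (hδ : IsLipBound r F δ) :
    ∫ σ, F σ ∂μ = ∫ σ, F σ ∂ν := by
  classical
  haveI := hμ.isProbabilityMeasure
  haveI := hν.isProbabilityMeasure
  -- the Lipschitz vector cut down to `Δ`
  set δΔ : V → ℝ := fun x => if x ∈ Δ then δ x else 0 with hδΔ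
  have hδΔ' : IsLipBound r F δΔ := hδ.restrict hFdep
  set SΔ : ℝ := ∑ x ∈ Δ, δ x with hSΔ
  have hSΔ0 : 0 ≤ SΔ := Finset.sum_nonneg fun x _ => hδ.nonneg x
  -- the bound at every level
  have step : ∀ m : ℕ, |∫ σ, F σ ∂μ - ∫ σ, F σ ∂ν| ≤ R * Real.exp (-(t * m)) * SΔ := by
    intro m
    obtain ⟨Λ, ρ, hΔΛ, hρout, hρunc, hρ, hm⟩ := hexh Δ m
    have hFdepΛ : DependsOn F (Λ : Set V) :=
      hFdep.mono fun v hv => Finset.mem_coe.2 (hΔΛ (Finset.mem_coe.1 hv))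
    -- the two-boundary-condition bound, for every pair of boundary conditions
    have hpair : ∀ ω η : V → S, |∫ σ, F σ ∂(γ Λ ω) - ∫ σ, F σ ∂(γ Λ η)| ≤
        R * Real.exp (-(t * m)) * SΔ := by
      intro ω η
      have h := abs_integral_sub_integral_le_window_weighted hγ hr0 hrR hR hrr hK0 hcontract ht.le hd0
        hKs hγ₀ hγ₁ hsumW Λ ω η ρ hρout hρunc hρ hFm hB hFdepΛ hδΔ'
      refine h.trans ?_
      have hs : ∑ x ∈ Λ, Real.exp (-(t * ρ x)) * δΔ x = ∑ x ∈ Δ, Real.exp (-(t * ρ x)) * δ x := by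
        have h1 : ∑ x ∈ Λ, Real.exp (-(t * ρ x)) * δΔ x =
            ∑ x ∈ Λ, (if x ∈ Δ then Real.exp (-(t * ρ x)) * δ x else 0) :=
          Finset.sum_congr rfl fun x _ => by simp only [hδΔ]; split_ifs <;> simp
        rw [h1, Finset.sum_ite_mem, Finset.inter_eq_right.2 hΔΛ]
      rw [hs, mul_assoc]
      refine mul_le_mul_of_nonneg_left ?_ hR
      rw [hSΔ, Finset.mul_sum]
      refine Finset.sum_le_sum fun x hx => mul_le_mul_of_nonneg_right ?_ (hδ.nonneg x)
      exact Real.exp_le_exp.2 (by nlinarith [hm x hx, ht])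
    -- DLR: `μ F = ∫ γ_Λ F dμ`, `ν F = ∫ γ_Λ F dν`
    rw [← hμ.integral_integral_eq hγ Λ (integrable_of_abs_le' hFm hB),
      ← hν.integral_integral_eq hγ Λ (integrable_of_abs_le' hFm hB)]
    -- two averages of a function with oscillation `≤ A` differ by at most `A`
    have hgm : Measurable fun σ => ∫ τ, F τ ∂(γ Λ σ) := measurable_windowAvg' hγ Λ hFm
    have hgB : ∀ σ, |∫ τ, F τ ∂(γ Λ σ)| ≤ B := fun σ => abs_windowAvg_le' hγ Λ hB σ
    have hiμ : Integrable (fun σ => ∫ τ, F τ ∂(γ Λ σ)) μ := integrable_of_abs_le' hgm hgB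
    have hiν : Integrable (fun σ => ∫ τ, F τ ∂(γ Λ σ)) ν := integrable_of_abs_le' hgm hgB
    set A : ℝ := R * Real.exp (-(t * m)) * SΔ
    have hpt : ∀ σ, |(∫ τ, F τ ∂(γ Λ σ)) - ∫ η, ∫ τ, F τ ∂(γ Λ η) ∂ν| ≤ A := fun σ => by
      have e : (∫ τ, F τ ∂(γ Λ σ)) - ∫ η, ∫ τ, F τ ∂(γ Λ η) ∂ν =
          ∫ η, ((∫ τ, F τ ∂(γ Λ σ)) - ∫ τ, F τ ∂(γ Λ η)) ∂ν := by
        rw [integral_sub (integrable_const _) hiν, integral_const, smul_eq_mul, probReal_univ, one_mul]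
      rw [e]
      calc |∫ η, ((∫ τ, F τ ∂(γ Λ σ)) - ∫ τ, F τ ∂(γ Λ η)) ∂ν|
          ≤ ∫ η, |(∫ τ, F τ ∂(γ Λ σ)) - ∫ τ, F τ ∂(γ Λ η)| ∂ν := abs_integral_le_integral_abs
        _ ≤ ∫ _η, A ∂ν := integral_mono ((integrable_const _).sub hiν).abs (integrable_const A)
            fun η => hpair σ η
        _ = A := by simp
    have e : (∫ σ, ∫ τ, F τ ∂(γ Λ σ) ∂μ) - ∫ η, ∫ τ, F τ ∂(γ Λ η) ∂ν =
        ∫ σ, ((∫ τ, F τ ∂(γ Λ σ)) - ∫ η, ∫ τ, F τ ∂(γ Λ η) ∂ν) ∂μ := by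
      rw [integral_sub hiμ (integrable_const _), integral_const, smul_eq_mul, probReal_univ, one_mul]
    rw [e]
    calc |∫ σ, ((∫ τ, F τ ∂(γ Λ σ)) - ∫ η, ∫ τ, F τ ∂(γ Λ η) ∂ν) ∂μ|
        ≤ ∫ σ, |(∫ τ, F τ ∂(γ Λ σ)) - ∫ η, ∫ τ, F τ ∂(γ Λ η) ∂ν| ∂μ := abs_integral_le_integral_abs
      _ ≤ ∫ _σ, A ∂μ := integral_mono (hiμ.sub (integrable_const _)).abs (integrable_const A) hpt
      _ = A := by simp
  -- let the level tend to infinity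
  have hlim : Tendsto (fun m : ℕ => R * Real.exp (-(t * m)) * SΔ) atTop (𝓝 (R * 0 * SΔ)) := by
    refine ((tendsto_const_nhds.mul ?_).mul tendsto_const_nhds)
    have h1 : Tendsto (fun m : ℕ => t * (m : ℝ)) atTop atTop :=
      Tendsto.const_mul_atTop ht tendsto_natCast_atTop_atTop
    exact Real.tendsto_exp_neg_atTop_nhds_zero.comp h1
  rw [mul_zero, zero_mul] at hlim
  have h0 : |∫ σ, F σ ∂μ - ∫ σ, F σ ∂ν| ≤ 0 :=
    ge_of_tendsto hlim (Eventually.of_forall step)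
  have := abs_nonneg (∫ σ, F σ ∂μ - ∫ σ, F σ ∂ν)
  exact sub_eq_zero.1 (abs_eq_zero.1 (le_antisymm h0 this))

section Determine

variable {M : Type*} [PseudoMetricSpace M] [MeasurableSpace M] [BorelSpace M]

/-- **Dobrushin–Shlosman's uniqueness theorem, weighted form, arbitrary range and arbitrary index set**
(Dobrushin–Shlosman 1985, Thm. 1: the window condition implies uniqueness of the Gibbs field; Georgii 2011
Thm. 8.7 / Remark 8.26 for the weighted one-site version; here: AT MOST one Gibbs measure, for window
kernels of infinite range under the weighted received-sum condition, and an arbitrary measurable spin space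
whose σ-algebra is induced by a map `val` into a metric space with `dist ∘ val ≤ A · r`, so that local
`r`-Lipschitz observables determine probability measures,
`DobrushinMetric.measure_eq_of_forall_integral_eq_of_isLipBound`). Hypotheses as in
`integral_eq_integral_of_window_weighted`. [cite: DobrushinShlosman1985, Theorem 1]
[cite: Georgii2011, Theorem 8.7] -/
theorem subsingleton_gibbsMeasures_of_window_weighted [DecidableEq V] {γ : Specification V S}
    (hγ : IsSpecification γ)
    {r : S → S → ℝ} {R : ℝ} (hr0 : ∀ a b, 0 ≤ r a b) (hrR : ∀ a b, r a b ≤ R) (hR : 0 ≤ R)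
    (hrr : ∀ a, r a a = 0)
    {win : V → Finset V} {K : V → V → V → ℝ} (hK0 : ∀ c y x, 0 ≤ K c y x)
    (hcontract : ∀ (c : V) (ω η : V → S) (f : (V → S) → ℝ) (δ : V → ℝ), Measurable f →
      (∃ B, ∀ σ, |f σ| ≤ B) → DependsOn f (win c : Set V) → (∀ x, 0 ≤ δ x) →
      (∀ (x : V) (σ τ : V → S), (∀ v, v ≠ x → σ v = τ v) → |f σ - f τ| ≤ δ x * r (σ x) (τ x)) →
        |∫ σ, f σ ∂(γ (win c) ω) - ∫ σ, f σ ∂(γ (win c) η)| ≤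
          ∑ x ∈ win c, δ x * ∑' y, K c y x * r (ω y) (η y))
    {t : ℝ} (ht : 0 < t) {d : V → V → V → ℝ} (hd0 : ∀ c y x, 0 ≤ d c y x)
    (hKs : ∀ c x, Summable fun y => K c y x * Real.exp (t * d c y x))
    {γ₀ : ℝ} (hγ₀ : 0 ≤ γ₀) (hγ₁ : γ₀ < 1)
    (hsumW : ∀ c, ∀ x ∈ win c, ∑' y, K c y x * Real.exp (t * d c y x) ≤ γ₀)
    (hexh : ∀ (Δ : Finset V) (m : ℕ), ∃ (Λ : Finset V) (ρ : V → ℝ), Δ ⊆ Λ ∧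
      (∀ y, y ∉ Λ → ρ y ≤ 0) ∧ (∀ x ∈ Λ, (∀ c ∈ Λ, win c ⊆ Λ → x ∉ win c) → ρ x ≤ 0) ∧
      (∀ c ∈ Λ, win c ⊆ Λ → ∀ x ∈ win c, ∀ y, K c y x ≠ 0 → ρ x ≤ ρ y + d c y x) ∧
      (∀ x ∈ Δ, (m : ℝ) ≤ ρ x))
    (val : S → M) (hS : ‹MeasurableSpace S› = MeasurableSpace.comap val ‹MeasurableSpace M›)
    {A : ℝ} (hA0 : 0 ≤ A) (hA : ∀ a b, dist (val a) (val b) ≤ A * r a b) :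
    (gibbsMeasures γ).Subsingleton := by
  classical
  intro μ hμ ν hν
  haveI := IsGibbsMeasure.isProbabilityMeasure hμ
  haveI := IsGibbsMeasure.isProbabilityMeasure hν
  refine measure_eq_of_forall_integral_eq_of_isLipBound val hS fun f Δ δ hfm hdep hf1 hδ => ?_
  -- an `A δ`-Lipschitz bound for the weight `r`
  -- (adapted from `DobrushinShlosman.subsingleton_gibbsMeasures_of_window`)
  have hδ' : IsLipBound r f fun y => A * δ y :=
    ⟨fun y => mul_nonneg hA0 (hδ.nonneg y), fun y σ τ hστ =>
      (hδ.le y σ τ hστ).trans (by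
        calc δ y * dist (val (σ y)) (val (τ y)) ≤ δ y * (A * r (σ y) (τ y)) :=
              mul_le_mul_of_nonneg_left (hA _ _) (hδ.nonneg y)
          _ = A * δ y * r (σ y) (τ y) := by ring)⟩
  exact integral_eq_integral_of_window_weighted hγ hr0 hrR hR hrr hK0 hcontract ht hd0 hKs hγ₀ hγ₁ hsumW
    hexh hμ hν hfm hf1 hdep hδ'

end Determine

end Literature.Probability.LatticeModels.DobrushinShlosman

end
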